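import Literature.NumberTheory.EllipticCurves.CyclotomicZpExtension
import Literature.NumberTheory.EllipticCurves.ZpExtensionUnitTwistProofs
import Literature.NumberTheory.GaloisRepresentations.CyclotomicLevels
import HarnessLib

/-!
# The cyclotomic `ℤ_p`-extension of `ℚ`, `p` odd: the `n`-th layer `ℚ_n` lies inside `ℚ(μ_{p^{n+1}})`,
# i.e. `Gal(ℚ̄/ℚ(μ_{p^{n+1}})) ≤ Gal(ℚ̄/ℚ_n)` — for the normalised `κ_cyc = ℓ ∘ χ_p` and for EVERY
# cyclotomic `κ : ZpExtension ℚ p` (proofs; no new definitions, no named facts)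

Topic `NumberTheory/EllipticCurves` (next to `CyclotomicZpExtension.lean`, whose objects it is about).
Seat `bsd-potss-rkm` (prover, cell `bsd-potss`, item stmt-BirchSwinnertonDyer-19196): this is the
first lemma of the BRIDGE between the two level systems of the tree — the Euler-system levels
`(cyclotomicLevelsRat p S).level k r = Gal(ℚ̄/ℚ(μ_{p^k}·∏ℓ))` of `GaloisRepresentations.CyclotomicLevels`
(on which `Kato2004.ZetaBody` families live) and the `ℤ_p`-tower layers `κ.layerSubgroup n =
Gal(ℚ̄/ℚ_n)` of `ZpExtension` (on which `Kato2004.IwasawaH1Data`, `SelmerDualData`, … are pinned):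
a class on the level `ℚ(μ_{p^{n+1}})` can be CORESTRICTED to the layer `ℚ_n` because
`Gal(ℚ̄/ℚ(μ_{p^{n+1}})) ≤ Gal(ℚ̄/ℚ_n)`, which is what this file proves.

## Statements

* `CyclotomicZp.pow_dvd_ell_of_norm_sub_one_le` — for `p` odd and a unit `u ≡ 1 (mod p^{n+1})`,
  `p^n ∣ ℓ(u)` for the normalised logarithm `ℓ` of `CyclotomicZpExtension.lean` (`γ_cyc^{t·ℓ(u)} = u^t`,
  `t = p − 1`): from `‖γ_cyc^y − 1‖ = ‖y‖·‖p‖` (`PadicOneUnits.norm_oneAddPow_sub_one`, Serre, *Cours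
  d'arithmétique* II.3.2) and `‖u^t − 1‖ ≤ ‖u − 1‖`.
* `CyclotomicZp.rootsOfUnityFixer_le_layerSubgroup_zpExtension` —
  `rootsOfUnityFixer ℚ (p^(n+1)) ≤ (zpExtension p).layerSubgroup n`: an automorphism fixing a
  primitive `p^{n+1}`-th root of unity has `χ_p(σ) ≡ 1 (mod p^{n+1})` (Mathlib's
  `cyclotomicCharacter.spec` through `GaloisRep.cyclotomicCharacter_spec` and `IsPrimitiveRoot.pow_inj`),
  hence `κ_cyc(σ) = ℓ(χ_p σ) ∈ p^n ℤ_p`.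
* `ZpExtension.IsCyclotomic.rootsOfUnityFixer_le_layerSubgroup` — the same for EVERY cyclotomic
  `κ` (`κ = κ_cyc.unitTwist u` by `IsCyclotomic.exists_eq_unitTwist_holds`; `layerSubgroup_unitTwist`).
* `ZpExtension.IsCyclotomic.cyclotomicLevelsRat_level_succ_le_layerSubgroup` — the Euler-system
  phrasing: `(cyclotomicLevelsRat p S).level (n+1) ∅ ≤ κ.layerSubgroup n`.

Only `p` odd is treated (for `p = 2`, `γ_cyc = 5` and the layer `ℚ_n` sits in `ℚ(μ_{2^{n+2}})`;
`-- TODO(general form)`). The converse direction (`Gal(ℚ̄/ℚ_n) ⊓ Gal(ℚ̄/ℚ(μ_p)) ≤ Gal(ℚ̄/ℚ(μ_{p^{n+1}}))`,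
i.e. `ℚ(μ_{p^{n+1}}) = ℚ_n(μ_p)`) is not needed for corestriction and is not proved here.

References: L. C. Washington, *Introduction to Cyclotomic Fields*, 2nd ed. (1997), §13.1
(`ℚ_∞ ⊂ ℚ(μ_{p^∞})`, `ℚ_n ⊂ ℚ(ζ_{p^{n+1}})` the fixed field of `Δ ≅ (ℤ/p)ˣ`) [Washington1997];
J.-P. Serre, *A Course in Arithmetic*, Ch. II §3.2 Prop. 8 (structure of `1 + pℤ_p`) [Serre1973];
tree: `CyclotomicZpExtension.lean` (`ell`, `cycPow`, `zpExtension`, `norm_sub_one_le_of_toZModPow_eq_one`),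
`ZpExtensionUnitTwistProofs.lean` (`IsCyclotomic.exists_eq_unitTwist_holds`), `CyclotomicLevels.lean`
(`rootsOfUnityFixer`, `cyclotomicLevelsRat_level`), `GaloisRep.lean` (`GaloisRep.cyclotomicCharacter_spec`).
-/

noncomputable section

open scoped NumberField
open Field
open Literature.NumberTheory.GaloisRepresentations
open Literature.NumberTheory.EllipticCurves Literature.NumberTheory.EllipticCurves.PadicOneUnits

namespace Literature.NumberTheory.EllipticCurves.CyclotomicZp

variable (p : ℕ) [Fact p.Prime]

omit [Fact p.Prime] in
/-- For odd `p` the cyclotomic exponent is `1` (`γ_cyc = 1 + p`) (local copy; cf.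
`Kato2004.TeichmullerBranchIndex`, not imported to keep this file light). [folklore] -/
private theorem cyclotomicExponent_of_ne_two (hp : p ≠ 2) : cyclotomicExponent p = 1 := if_neg hp

/-- For odd `p` the torsion order `#μ(ℤ_p)` is `p − 1` (local copy of
`Kato2004.torsionOrder_of_ne_two`, whose module is not imported to keep this file light). [folklore] -/
private theorem torsionOrder_of_ne_two (hp : p ≠ 2) : torsionOrder p = p - 1 := by
  rw [torsionOrder, cyclotomicExponent_of_ne_two p hp, pow_one, Nat.totient_prime (Fact.out : p.Prime)]

/-- `p − 1` is a unit of `ℤ_p` (local copy; cf. `Kato2004.SemilocalDecompositionProofs`). [folklore] -/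
private theorem isUnit_natCast_sub_one : IsUnit ((p - 1 : ℕ) : ℤ_[p]) := by
  have hp := (Fact.out : p.Prime)
  rw [PadicInt.isUnit_iff]
  refine le_antisymm (PadicInt.norm_le_one _) (not_lt.mp fun hlt => ?_)
  rw [← Int.cast_natCast, PadicInt.norm_int_lt_one_iff_dvd, Int.natCast_dvd_natCast] at hlt
  have h0 : p - 1 = 0 := Nat.eq_zero_of_dvd_of_lt hlt (Nat.sub_lt hp.pos Nat.one_pos)
  have := hp.two_le
  omega

/-- **`p^n ∣ ℓ(u)` for `u ≡ 1 (mod p^{n+1})`, `p` odd.**  With `t = p − 1` and `γ_cyc = 1 + p`: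
`γ_cyc^{t ℓ(u)} = u^t ≡ 1 (mod p^{n+1})` and `‖γ_cyc^y − 1‖ = ‖y‖·‖p‖` (Serre, *Cours
d'arithmétique* II.3.2) give `‖t ℓ(u)‖ ≤ ‖p^n‖`, and `t` is a unit — i.e. `log_p(1 + p^{n+1}ℤ_p) = p^{n+1}ℤ_p = p^n · log_p(γ_cyc)ℤ_p`
for odd `p`. [cite: Serre1973, Ch. II §3.2 Prop. 8] -/
theorem pow_dvd_ell_of_norm_sub_one_le (hp : p ≠ 2) (u : ℤ_[p]ˣ) (n : ℕ)
    (hu : ‖(u : ℤ_[p]) - 1‖ ≤ ‖(p : ℤ_[p]) ^ (n + 1)‖) : (p : ℤ_[p]) ^ n ∣ ell p u := by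
  have hprime := (Fact.out : p.Prime)
  set y : ℤ_[p] := torsionOrder p * ell p u with hy
  -- `γ_cyc^y = u^t`
  have h1 : cycPow p y = (u : ℤ_[p]) ^ torsionOrder p := cycPow_torsionOrder_mul_ell p u
  -- `‖γ_cyc^y − 1‖ = ‖y‖ · ‖p‖`
  have he : cyclotomicExponent p - 1 + 3 ≤ p * (cyclotomicExponent p - 1 + 1) := by
    rw [cyclotomicExponent_of_ne_two p hp]
    have := hprime.two_le
    omega
  have h2 : ‖cycPow p y - 1‖ = ‖y‖ * ‖(p : ℤ_[p]) ^ (cyclotomicExponent p - 1 + 1)‖ :=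
    norm_oneAddPow_sub_one (p := p) (cyclotomicExponent p - 1) he y
  rw [cyclotomicExponent_of_ne_two p hp, Nat.sub_self, zero_add, pow_one] at h2
  -- `‖u^t − 1‖ ≤ ‖u − 1‖`
  have h3 : ‖(u : ℤ_[p]) ^ torsionOrder p - 1‖ ≤ ‖(u : ℤ_[p]) - 1‖ := by
    have hdvd : (u : ℤ_[p]) - 1 ∣ (u : ℤ_[p]) ^ torsionOrder p - 1 := by
      simpa using sub_dvd_pow_sub_pow (u : ℤ_[p]) 1 (torsionOrder p)
    exact norm_le_of_dvd hdvd
  -- so `‖y‖ · ‖p‖ ≤ ‖p‖^(n+1)`, i.e. `‖y‖ ≤ ‖p^n‖`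
  have hp0 : (0 : ℝ) < ‖(p : ℤ_[p])‖ := norm_pos_iff.mpr (by exact_mod_cast hprime.ne_zero)
  have h4 : ‖y‖ * ‖(p : ℤ_[p])‖ ≤ ‖(p : ℤ_[p])‖ ^ n * ‖(p : ℤ_[p])‖ := by
    rw [← pow_succ, ← norm_pow, ← h2, h1]
    exact h3.trans hu
  have h5 : ‖y‖ ≤ ‖(p : ℤ_[p]) ^ n‖ := by
    rw [norm_pow]
    exact le_of_mul_le_mul_right h4 hp0
  have h6 : (p : ℤ_[p]) ^ n ∣ y :=
    dvd_of_norm_le (pow_ne_zero _ (by exact_mod_cast hprime.ne_zero)) h5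
  -- remove the unit `t = p − 1`
  rw [hy, torsionOrder_of_ne_two p hp] at h6
  exact (isUnit_natCast_sub_one p).dvd_mul_left.mp h6

/-- **`Gal(ℚ̄/ℚ(μ_{p^{n+1}})) ≤ Gal(ℚ̄/ℚ_n)` for the normalised cyclotomic `ℤ_p`-extension
`κ_cyc = ℓ ∘ χ_p` of `ℚ`, `p` odd**: an automorphism fixing the `p^{n+1}`-th roots of unity has
`χ_p(σ) ≡ 1 (mod p^{n+1})`, hence `κ_cyc(σ) = ℓ(χ_p σ) ∈ p^n ℤ_p`. (Washington, *Introduction to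
Cyclotomic Fields* §13.1: `ℚ_n ⊂ ℚ(ζ_{p^{n+1}})` is the fixed field of `Δ ≅ (ℤ/p)ˣ`.)
[cite: Washington1997, §13.1] -/
theorem rootsOfUnityFixer_le_layerSubgroup_zpExtension (hp : p ≠ 2) (n : ℕ) :
    rootsOfUnityFixer ℚ (p ^ (n + 1)) ≤ (zpExtension p).layerSubgroup n := by
  intro σ hσ
  have hprime := (Fact.out : p.Prime)
  rw [ZpExtension.mem_layerSubgroup, zpExtension_apply, toAdd_ofAdd]
  refine pow_dvd_ell_of_norm_sub_one_le p hp _ n (norm_sub_one_le_of_toZModPow_eq_one p ?_)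
  -- `χ_p(σ) ≡ 1 (mod p^{n+1})` from `σ ζ = ζ` for a primitive `p^{n+1}`-th root of unity `ζ`
  haveI : NeZero (p ^ (n + 1)) := ⟨pow_ne_zero _ hprime.ne_zero⟩
  obtain ⟨ζ, hζ⟩ := HasEnoughRootsOfUnity.exists_primitiveRoot (AlgebraicClosure ℚ) (p ^ (n + 1))
  have hfix : σ • ζ = ζ := hσ ζ hζ.pow_eq_one
  have hspec := GaloisRep.cyclotomicCharacter_spec ℚ p (k := n + 1) σ ζ hζ.pow_eq_one
  rw [hfix] at hspec
  -- `ζ^1 = ζ^v` with `v = (χ_p σ mod p^{n+1}).val < p^{n+1}`, so `v = 1`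
  set x := (GaloisRep.cyclotomicCharacter ℚ p σ).val.toZModPow (n + 1) with hx
  have hlt : 1 < p ^ (n + 1) := Nat.one_lt_pow (Nat.succ_ne_zero n) hprime.one_lt
  have hv1 : 1 = x.val := by
    refine hζ.pow_inj hlt (ZMod.val_lt _) ?_
    rw [pow_one]
    exact hspec
  haveI : Fact (1 < p ^ (n + 1)) := ⟨hlt⟩
  apply ZMod.val_injective
  rw [ZMod.val_one, ← hv1]

end Literature.NumberTheory.EllipticCurves.CyclotomicZp

namespace Literature.NumberTheory.EllipticCurves.ZpExtension

variable {p : ℕ} [Fact p.Prime]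

/-- **`Gal(ℚ̄/ℚ(μ_{p^{n+1}})) ≤ Gal(ℚ̄/ℚ_n)` for EVERY cyclotomic `ℤ_p`-extension `κ` of `ℚ`, `p`
odd** (`κ` is a unit twist of `κ_cyc`, and unit twists do not move the layers): `ℚ_n`, the unique
subfield of `ℚ_∞` of degree `p^n`, lies in `ℚ(ζ_{p^{n+1}})`. [cite: Washington1997, §13.1] -/
theorem IsCyclotomic.rootsOfUnityFixer_le_layerSubgroup {κ : ZpExtension ℚ p}
    (hκ : κ.IsCyclotomic) (hp : p ≠ 2) (n : ℕ) :
    rootsOfUnityFixer ℚ (p ^ (n + 1)) ≤ κ.layerSubgroup n := by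
  obtain ⟨u, rfl⟩ := IsCyclotomic.exists_eq_unitTwist_holds
    (CyclotomicZp.isCyclotomic_zpExtension p) hκ
  rw [layerSubgroup_unitTwist]
  exact CyclotomicZp.rootsOfUnityFixer_le_layerSubgroup_zpExtension p hp n

/-- The same inclusion in the language of the tree's Euler-system levels: the `p`-power level
`(cyclotomicLevelsRat p S).level (n+1) ∅ = Gal(ℚ̄/ℚ(μ_{p^{n+1}}))` is contained in the layer
subgroup `Gal(ℚ̄/ℚ_n)` of every cyclotomic `κ` (`p` odd) — so a class on the level
`ℚ(μ_{p^{n+1}})` CORESTRICTS to the layer `ℚ_n` of the `ℤ_p`-tower. [cite: Washington1997, §13.1] -/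
theorem IsCyclotomic.cyclotomicLevelsRat_level_succ_le_layerSubgroup {κ : ZpExtension ℚ p}
    (hκ : κ.IsCyclotomic) (hp : p ≠ 2) (S : Set (IsDedekindDomain.HeightOneSpectrum (𝓞 ℚ)))
    (n : ℕ) :
    (cyclotomicLevelsRat p S).level (n + 1) ∅ ≤ κ.layerSubgroup n :=
  le_trans (by rw [cyclotomicLevelsRat_level]; exact inf_le_left)
    (hκ.rootsOfUnityFixer_le_layerSubgroup hp n)

-- TODO(general form): `p = 2` (`ℚ_n ⊂ ℚ(μ_{2^{n+2}})`), a general number field `K` in place of `ℚ`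
-- (`K_n ⊂ K(μ_{p^{n+c}})` with the shift `c` determined by `μ_{p^∞}(K)`), and the converse inclusion.

end Literature.NumberTheory.EllipticCurves.ZpExtension

end
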